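import Summits.ABC.ABC.Theses.RibetTakahashiSplit

/-!
# Strategist sketch — typed signatures quoted in `STRATEGY-CENSUS.md`
(crux stmt-ABC-1561 `RibetTakahashiSplit.ManyPrimeValuationProduct`; planner-cstrat-stmt-ABC-1561-0, 2026-08-16)

Definitions only (no claims): the strengthenings S⁺ and decomposition pieces discussed in the census,
stated over the crux's own vocabulary so that each elaborates.  `T(W)` below is the crux's product
`∏_{p ∣ N, p² ∤ N} (Δ_min).factorization p`.
-/

set_option linter.dupNamespace false

namespace Summit.ABC.ABC.Cruxes.ManyPrimeValuationProduct.Strategist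

open Summit.ABC.ABC.Theses.RibetTakahashiSplit

/-- The valuation product `T(W)` of the crux. -/
noncomputable def valProd (W : WeierstrassCurve ℚ) : ℕ :=
  ∏ p ∈ (W.conductorNorm ℤ).primeFactors with ¬ p ^ 2 ∣ W.conductorNorm ℤ,
    (W.minimalDiscriminantNorm ℤ).factorization p

/-- Number of odd multiplicative primes. -/
noncomputable def oddMultCount (W : WeierstrassCurve ℚ) : ℕ :=
  ((W.conductorNorm ℤ).primeFactors.filter (fun p => p ≠ 2 ∧ ¬ p ^ 2 ∣ W.conductorNorm ℤ)).card

/-- Semistable away from 2. -/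
def SemistableAwayFromTwo (W : WeierstrassCurve ℚ) : Prop :=
  ∀ p : ℕ, p.Prime → p ≠ 2 → ¬ p ^ 2 ∣ W.conductorNorm ℤ

/-! ## Strengthen -/

/-- **S4 (function-field shape).** `T(W) ≤ C^{ω}`: the geometric mean of the multiplicative exponents
is bounded.  Over `k(t)` this is Mason–Stothers + AM–GM (`∏ mult ≤ 3^{#roots}`); over `ℚ` it would
IMPLY the crux (`C^{ω(N)} ≤ N^{log C/ log log N}`) and is FALSE at truth level (Masser's Szpiro-sharp
families: exponents `≍ √log N / log p`).  Census §Strengthen S4. -/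
def ValuationProductExpOmega : Prop :=
  ∃ C : ℝ, ∀ (W : WeierstrassCurve ℚ) [W.IsElliptic], SemistableAwayFromTwo W → 4 ≤ oddMultCount W →
    (valProd W : ℝ) ≤ C ^ (W.conductorNorm ℤ).primeFactors.card

/-- **S3 (isogeny-uniform form).** The crux uniformly over the `ℚ`-isogeny class, i.e. with `T`
replaced by its maximum over curves isogenous to `W` (by Mazur–Kenku the two differ by `≤ 163^{ω}`,
so this is crux-EQUIVALENT, census §Strengthen S3). -/
def ManyPrimeValuationProductIsogenyUniform : Prop :=
  ∀ ε : ℝ, 0 < ε → ∃ C : ℝ, ∀ (W W' : WeierstrassCurve ℚ) [W.IsElliptic] [W'.IsElliptic],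
    SemistableAwayFromTwo W → 4 ≤ oddMultCount W → W.IsIsogenous W' →
    (valProd W' : ℝ) ≤ C * (W.conductorNorm ℤ : ℝ) ^ ε

/-- **S1** is `Summit.ABC.ABC.Cruxes.ManyPrimeValuationProduct.Disproof.QuasiPolySzpiroAwayFromTwo`
(Disproof.lean §5); restated here verbatim for the census. -/
def QuasiPolySzpiroAwayFromTwo : Prop :=
  ∀ η : ℝ, 0 < η → ∃ C : ℝ, ∀ (W : WeierstrassCurve ℚ) [W.IsElliptic],
    SemistableAwayFromTwo W →
    Real.log (W.minimalDiscriminantNorm ℤ : ℝ) ≤ C * (1 + Real.log (W.conductorNorm ℤ : ℝ)) ^ (1 + η)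

/-! ## Decomposition -/

/-- **D1 (class split), the non-Frey piece**: the crux on curves WITHOUT a (twisted) Frey–Hellegouarch
model.  With the route item `ManyPrimeValuationProductFrey` (stmt-ABC-15149) it gives the crux back by
excluded middle (`manyPrime_of_frey_of_nonFrey` below); it is the crux restricted to a subclass and is
Conj. 1.14-hard there (census §Decomposition D1). -/
def ManyPrimeValuationProductNonFrey : Prop :=
  ∀ ε : ℝ, 0 < ε → ∃ C : ℝ, ∀ (W : WeierstrassCurve ℚ) [W.IsElliptic], SemistableAwayFromTwo W →
    ¬ (∃ (a b d : ℤ) (C' : WeierstrassCurve.VariableChange ℚ), IsCoprime a b ∧ a * b * (a + b) ≠ 0 ∧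
        d ∣ 2 ∧ C' • W = Literature.NumberTheory.EllipticCurves.freyCurve (d * a) (d * b)) →
    4 ≤ oddMultCount W → (valProd W : ℝ) ≤ C * (W.conductorNorm ℤ : ℝ) ^ ε

/-- D1 glue (trivial): Frey piece + non-Frey piece ⇒ crux. -/
theorem manyPrime_of_frey_of_nonFrey (hF : ManyPrimeValuationProductFrey)
    (hN : ManyPrimeValuationProductNonFrey) : ManyPrimeValuationProduct := by
  intro ε hε
  obtain ⟨C₁, hC₁⟩ := hF ε hε
  obtain ⟨C₂, hC₂⟩ := hN ε hε
  refine ⟨max C₁ C₂, fun W _ hss h4 => ?_⟩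
  have hNpos : (0:ℝ) ≤ (W.conductorNorm ℤ : ℝ) ^ ε := by positivity
  by_cases hFrey : ∃ (a b d : ℤ) (C' : WeierstrassCurve.VariableChange ℚ), IsCoprime a b ∧
      a * b * (a + b) ≠ 0 ∧ d ∣ 2 ∧ C' • W = Literature.NumberTheory.EllipticCurves.freyCurve (d * a) (d * b)
  · exact (hC₁ W hss hFrey h4).trans (mul_le_mul_of_nonneg_right (le_max_left _ _) hNpos)
  · exact (hC₂ W hss hFrey h4).trans (mul_le_mul_of_nonneg_right (le_max_right _ _) hNpos)

/-- **D2 (regime split), large-ω piece**: `ω(N)·log log N ≥ √(log N)·…` — typed with an explicit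
threshold function `(log N)^{1/2} ≤ ω`. -/
def ManyPrimeValuationProductLargeOmega : Prop :=
  ∀ ε : ℝ, 0 < ε → ∃ C : ℝ, ∀ (W : WeierstrassCurve ℚ) [W.IsElliptic], SemistableAwayFromTwo W →
    4 ≤ oddMultCount W → Real.sqrt (Real.log (W.conductorNorm ℤ)) ≤ (W.conductorNorm ℤ).primeFactors.card →
    (valProd W : ℝ) ≤ C * (W.conductorNorm ℤ : ℝ) ^ ε

/-- **D2, small-ω piece.** -/
def ManyPrimeValuationProductSmallOmega : Prop :=
  ∀ ε : ℝ, 0 < ε → ∃ C : ℝ, ∀ (W : WeierstrassCurve ℚ) [W.IsElliptic], SemistableAwayFromTwo W →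
    4 ≤ oddMultCount W → ((W.conductorNorm ℤ).primeFactors.card : ℝ) < Real.sqrt (Real.log (W.conductorNorm ℤ)) →
    (valProd W : ℝ) ≤ C * (W.conductorNorm ℤ : ℝ) ^ ε

/-- D2 glue (trivial). -/
theorem manyPrime_of_regimes (hL : ManyPrimeValuationProductLargeOmega)
    (hS : ManyPrimeValuationProductSmallOmega) : ManyPrimeValuationProduct := by
  intro ε hε
  obtain ⟨C₁, hC₁⟩ := hL ε hε
  obtain ⟨C₂, hC₂⟩ := hS ε hε
  refine ⟨max C₁ C₂, fun W _ hss h4 => ?_⟩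
  have hNpos : (0:ℝ) ≤ (W.conductorNorm ℤ : ℝ) ^ ε := by positivity
  rcases le_or_gt (Real.sqrt (Real.log (W.conductorNorm ℤ))) ((W.conductorNorm ℤ).primeFactors.card : ℝ) with h | h
  · exact (hC₁ W hss h4 h).trans (mul_le_mul_of_nonneg_right (le_max_left _ _) hNpos)
  · exact (hC₂ W hss h4 h).trans (mul_le_mul_of_nonneg_right (le_max_right _ _) hNpos)

/-! ## θ-ladder rung (what would move the judge; NOT the crux) -/

/-- **Milestone rung `θ`**: `T(W) ≤ K N^{θ+ε}` on SEMISTABLE curves with many multiplicative primes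
(Pasten Thm 16.5 shape, `n ≥ 3 + c/ε`).  Printed: `θ = 8/3` (arXiv:1705.09251 Thm 16.5); census
§What-would-move-it: `θ = 13/6` from Pasten's proof with Thm 8.1 replaced by the sup-norm bound of
Khayutin–Nelson–Steiner (arXiv:2207.12351 Thm 6).  `θ = 0` is the crux on the semistable class. -/
def ValuationProductRung (θ c : ℝ) : Prop :=
  ∀ ε : ℝ, 0 < ε → ∃ K : ℝ, ∀ (W : WeierstrassCurve ℚ) [W.IsElliptic],
    (∀ p : ℕ, p.Prime → ¬ p ^ 2 ∣ W.conductorNorm ℤ) →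
    3 + c / ε ≤ ((W.conductorNorm ℤ).primeFactors.card : ℝ) →
    (valProd W : ℝ) ≤ K * (W.conductorNorm ℤ : ℝ) ^ (θ + ε)

end Summit.ABC.ABC.Cruxes.ManyPrimeValuationProduct.Strategist
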